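import Mathlib

/-!
# Uniqueness of the Laplace transform of a bounded continuous function on `[0, ∞)`

Helper (`--supports`) for the line `bath-bond-deficit-integral` of the crux
`BondHeatUncertainty.SubdiffusiveBondHeat` (stmt-AtomisticToContinuum-9120): the registered stub
`stub_laplaceUnique` of the lead's skeleton (kernel detailed balance via equality of Laplace
transforms).

**Statement.** If `φ : ℝ → ℝ` is continuous on `[0, ∞)`, bounded there, and
`∫_{(0,∞)} e^{-λ s} φ(s) ds = 0` for every `λ > 0`, then `φ = 0` on `[0, ∞)`.

**Proof.** Taking `λ = n + 1` gives `∫_{(0,∞)} e^{-s} p(e^{-s}) φ(s) ds = 0` for every real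
polynomial `p` (`Polynomial.induction_on'`).  By Weierstrass on `[0, 1]`
(`exists_polynomial_near_of_continuousOn`) and the domination `|e^{-s} g(e^{-s}) φ(s)| ≤ M C e^{-s}`
this extends to every continuous `g : ℝ → ℝ` in place of `p`.  For `s₀ > 0` put `u₀ = e^{-s₀}`
and test with `g(u) = β(u) ψ(-log (max u (u₀/2)))`, where `β(u) = max 0 (u₀/2 - |u - u₀|)` is a
tent supported in `[u₀/2, 3u₀/2]` and `ψ(s) = φ(max s 0)` is the continuous extension of `φ`:
on `(0, ∞)` the integrand equals the continuous nonnegative function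
`G(s) = e^{-s} β(e^{-s}) ψ(s)²` with `G(s₀) = e^{-s₀} (u₀/2) φ(s₀)²`, so `∫_{(0,∞)} G = 0`
forces `φ(s₀) = 0` (`setIntegral_pos_iff_support_of_nonneg_ae`, open sets have positive
Lebesgue measure).  Finally `φ(0) = 0` by continuity from the right.
-/

noncomputable section

open MeasureTheory Set Filter Topology

namespace Summit.AtomisticToContinuum.FouriersLaw.Theorems.SubdiffusiveBondHeat

/-- **Uniqueness of the Laplace transform** (bounded continuous case). A function `φ`,
continuous and bounded on `[0, ∞)`, whose Laplace transform `∫_{(0,∞)} e^{-λ s} φ(s) ds`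
vanishes for every `λ > 0`, vanishes identically on `[0, ∞)`. [folklore] -/
theorem stub_laplaceUnique : ∀ φ : ℝ → ℝ, ContinuousOn φ (Set.Ici 0) → (∃ C : ℝ, ∀ s, 0 ≤ s → |φ s| ≤ C) → (∀ lam' : ℝ, 0 < lam' → ∫ s in Set.Ioi (0 : ℝ), Real.exp (-(lam' * s)) * φ s = 0) → ∀ s, 0 ≤ s → φ s = 0 := by
  intro φ hφ hbdd hL
  -- a positive bound `C` for `|φ|` on `[0, ∞)`
  obtain ⟨C, hCpos, hφC⟩ : ∃ C : ℝ, 0 < C ∧ ∀ s, 0 ≤ s → |φ s| ≤ C := by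
    obtain ⟨C₀, hC₀⟩ := hbdd
    exact ⟨max C₀ 1, lt_of_lt_of_le one_pos (le_max_right _ _),
      fun s hs => (hC₀ s hs).trans (le_max_left _ _)⟩
  -- `φ` is a.e.-strongly measurable on `(0, ∞)`
  have hφm : AEStronglyMeasurable φ (volume.restrict (Ioi (0 : ℝ))) :=
    (hφ.mono Ioi_subset_Ici_self).aestronglyMeasurable measurableSet_Ioi
  -- the monomial identity `e^{-s} (e^{-s})^n = e^{-(n+1) s}`
  have hexp : ∀ (n : ℕ) (s : ℝ),
      Real.exp (-s) * Real.exp (-s) ^ n = Real.exp (-(((n : ℝ) + 1) * s)) := by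
    intro n s
    rw [← pow_succ', ← Real.exp_nat_mul]
    congr 1
    push_cast
    ring
  -- Step A: domination `|e^{-s} g(e^{-s}) φ(s)| ≤ M C e^{-s}` gives integrability and a bound
  have hA : ∀ g : ℝ → ℝ, Continuous g → ∀ M : ℝ, (∀ u ∈ Icc (0 : ℝ) 1, |g u| ≤ M) →
      IntegrableOn (fun s => Real.exp (-s) * g (Real.exp (-s)) * φ s) (Ioi 0) ∧
        |∫ s in Ioi (0 : ℝ), Real.exp (-s) * g (Real.exp (-s)) * φ s| ≤ M * C := by
    intro g hg M hM
    have hbound : ∀ᵐ s ∂(volume.restrict (Ioi (0 : ℝ))),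
        ‖Real.exp (-s) * g (Real.exp (-s)) * φ s‖ ≤ M * C * Real.exp (-s) := by
      refine (ae_restrict_mem measurableSet_Ioi).mono fun s hs => ?_
      have hs' : 0 < s := hs
      have h1 : |g (Real.exp (-s))| ≤ M :=
        hM _ ⟨(Real.exp_pos _).le, Real.exp_le_one_iff.mpr (neg_nonpos.mpr hs'.le)⟩
      have h2 : |φ s| ≤ C := hφC s hs'.le
      have hM0 : 0 ≤ M := (abs_nonneg _).trans h1
      rw [Real.norm_eq_abs, abs_mul, abs_mul, abs_of_pos (Real.exp_pos _)]
      calc Real.exp (-s) * |g (Real.exp (-s))| * |φ s|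
          ≤ Real.exp (-s) * M * C := by gcongr
        _ = M * C * Real.exp (-s) := by ring
    have hdom : IntegrableOn (fun s => M * C * Real.exp (-s)) (Ioi (0 : ℝ)) :=
      (integrableOn_exp_neg_Ioi 0).const_mul (M * C)
    have hmeas : AEStronglyMeasurable (fun s => Real.exp (-s) * g (Real.exp (-s)) * φ s)
        (volume.restrict (Ioi (0 : ℝ))) := by
      have hc : Continuous fun s : ℝ => Real.exp (-s) * g (Real.exp (-s)) := by fun_prop
      exact hc.aestronglyMeasurable.mul hφm
    refine ⟨Integrable.mono' hdom hmeas hbound, ?_⟩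
    calc |∫ s in Ioi (0 : ℝ), Real.exp (-s) * g (Real.exp (-s)) * φ s|
        = ‖∫ s in Ioi (0 : ℝ), Real.exp (-s) * g (Real.exp (-s)) * φ s‖ :=
          (Real.norm_eq_abs _).symm
      _ ≤ ∫ s in Ioi (0 : ℝ), M * C * Real.exp (-s) := norm_integral_le_of_norm_le hdom hbound
      _ = M * C := by rw [integral_const_mul, integral_exp_neg_Ioi_zero, mul_one]
  -- integrability for every continuous `g`
  have hA0 : ∀ g : ℝ → ℝ, Continuous g →
      IntegrableOn (fun s => Real.exp (-s) * g (Real.exp (-s)) * φ s) (Ioi 0) := by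
    intro g hg
    obtain ⟨M, hM⟩ := isCompact_Icc.exists_bound_of_continuousOn (hg.continuousOn (s := Icc 0 1))
    exact (hA g hg M fun u hu => (Real.norm_eq_abs _).symm.le.trans (hM u hu)).1
  -- Step B: the test integral vanishes for polynomials
  have hB : ∀ p : Polynomial ℝ,
      ∫ s in Ioi (0 : ℝ), Real.exp (-s) * p.eval (Real.exp (-s)) * φ s = 0 := by
    intro p
    refine p.induction_on' ?_ ?_
    · intro p q hp hq
      simp only [Polynomial.eval_add]
      calc ∫ s in Ioi (0 : ℝ),
            Real.exp (-s) * (p.eval (Real.exp (-s)) + q.eval (Real.exp (-s))) * φ s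
          = ∫ s in Ioi (0 : ℝ), (Real.exp (-s) * p.eval (Real.exp (-s)) * φ s
              + Real.exp (-s) * q.eval (Real.exp (-s)) * φ s) := by
            congr 1; ext s; ring
        _ = 0 := by
            rw [integral_add (hA0 _ p.continuous) (hA0 _ q.continuous), hp, hq, add_zero]
    · intro n a
      simp only [Polynomial.eval_monomial]
      calc ∫ s in Ioi (0 : ℝ), Real.exp (-s) * (a * Real.exp (-s) ^ n) * φ s
          = ∫ s in Ioi (0 : ℝ), a * (Real.exp (-(((n : ℝ) + 1) * s)) * φ s) := by
            congr 1; ext s; rw [← hexp n s]; ring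
        _ = 0 := by rw [integral_const_mul, hL _ (by positivity), mul_zero]
  -- Step C: ... hence for every continuous `g` (Weierstrass on `[0, 1]`)
  have hC : ∀ g : ℝ → ℝ, Continuous g →
      ∫ s in Ioi (0 : ℝ), Real.exp (-s) * g (Real.exp (-s)) * φ s = 0 := by
    intro g hg
    have key : ∀ ε : ℝ, 0 < ε →
        |∫ s in Ioi (0 : ℝ), Real.exp (-s) * g (Real.exp (-s)) * φ s| ≤ ε := by
      intro ε hε
      obtain ⟨p, hp⟩ :=
        exists_polynomial_near_of_continuousOn 0 1 g hg.continuousOn (ε / C) (div_pos hε hCpos)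
      have hsub := hA (fun u => g u - p.eval u) (hg.sub p.continuous) (ε / C)
        (fun u hu => by rw [abs_sub_comm]; exact (hp u hu).le)
      have hsplit : ∫ s in Ioi (0 : ℝ), Real.exp (-s) * g (Real.exp (-s)) * φ s
          = ∫ s in Ioi (0 : ℝ), Real.exp (-s) * (g (Real.exp (-s)) - p.eval (Real.exp (-s))) * φ s := by
        rw [show (fun s => Real.exp (-s) * (g (Real.exp (-s)) - p.eval (Real.exp (-s))) * φ s)
              = fun s => Real.exp (-s) * g (Real.exp (-s)) * φ s
                  - Real.exp (-s) * p.eval (Real.exp (-s)) * φ s from funext fun s => by ring,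
          integral_sub (hA0 g hg) (hA0 _ p.continuous), hB p, sub_zero]
      rw [hsplit]
      calc _ ≤ ε / C * C := hsub.2
        _ = ε := div_mul_cancel₀ ε hCpos.ne'
    have h0 : |∫ s in Ioi (0 : ℝ), Real.exp (-s) * g (Real.exp (-s)) * φ s| ≤ 0 :=
      le_of_forall_pos_le_add fun ε hε => by rw [zero_add]; exact key ε hε
    exact abs_nonpos_iff.mp h0
  -- the continuous extension `ψ s = φ (max s 0)` of `φ`
  obtain ⟨ψ, hψc, hψeq⟩ : ∃ ψ : ℝ → ℝ, Continuous ψ ∧ ∀ s, 0 ≤ s → ψ s = φ s :=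
    ⟨fun s => φ (max s 0), hφ.comp_continuous (continuous_id.max continuous_const)
      (fun s => Set.mem_Ici.mpr (le_max_right _ _)), fun s hs => by simp [max_eq_left hs]⟩
  -- Step D: `φ = 0` on `(0, ∞)`
  have hD : ∀ s, 0 < s → φ s = 0 := by
    intro s₀ hs₀
    by_contra hne
    obtain ⟨u₀, hu₀, hu₀eq⟩ : ∃ u₀ : ℝ, 0 < u₀ ∧ Real.exp (-s₀) = u₀ := ⟨_, Real.exp_pos _, rfl⟩
    -- the tent `β`
    obtain ⟨β, hβc, hβ0, hβvan, hβu₀⟩ : ∃ β : ℝ → ℝ, Continuous β ∧ (∀ u, 0 ≤ β u) ∧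
        (∀ u, u ≤ u₀ / 2 → β u = 0) ∧ β u₀ = u₀ / 2 := by
      refine ⟨fun u => max 0 (u₀ / 2 - |u - u₀|), by fun_prop, fun u => le_max_left _ _,
        fun u hu => ?_, ?_⟩
      · have : u₀ / 2 ≤ |u - u₀| := by
          rw [abs_sub_comm, abs_of_nonneg (by linarith)]
          linarith
        exact max_eq_left (by linarith)
      · simp only [sub_self, abs_zero, sub_zero]
        exact max_eq_right (half_pos hu₀).le
    -- the test function `g`
    have hgc : Continuous fun u => β u * ψ (-Real.log (max u (u₀ / 2))) :=
      hβc.mul (hψc.comp <| continuous_neg.comp <|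
        (continuous_id.max continuous_const).log fun u =>
          (lt_max_of_lt_right (half_pos hu₀)).ne')
    have hI := hC _ hgc
    -- on `(0, ∞)` the integrand is the nonnegative continuous `G`
    set G : ℝ → ℝ := fun s => Real.exp (-s) * β (Real.exp (-s)) * ψ s ^ 2 with hGdef
    have hGc : Continuous G := by fun_prop
    have hG0 : ∀ s, 0 ≤ G s := fun s =>
      mul_nonneg (mul_nonneg (Real.exp_pos _).le (hβ0 _)) (sq_nonneg _)
    have hGeq : EqOn (fun s => Real.exp (-s) * (β (Real.exp (-s)) *
        ψ (-Real.log (max (Real.exp (-s)) (u₀ / 2)))) * φ s) G (Ioi 0) := by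
      intro s hs
      have hs' : 0 < s := hs
      simp only [hGdef]
      rcases le_or_gt (Real.exp (-s)) (u₀ / 2) with h | h
      · rw [hβvan _ h]; ring
      · rw [max_eq_left h.le, Real.log_exp, neg_neg, hψeq s hs'.le]; ring
    have hGI : ∫ s in Ioi (0 : ℝ), G s = 0 := by
      rw [← setIntegral_congr_fun measurableSet_Ioi hGeq]; exact hI
    have hGint : IntegrableOn G (Ioi 0) := (hA0 _ hgc).congr_fun hGeq measurableSet_Ioi
    have hGs₀ : 0 < G s₀ := by
      simp only [hGdef]
      rw [hu₀eq, hβu₀, hψeq s₀ hs₀.le]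
      exact mul_pos (mul_pos hu₀ (half_pos hu₀)) (sq_pos_of_ne_zero hne)
    have hpos : 0 < ∫ s in Ioi (0 : ℝ), G s := by
      rw [setIntegral_pos_iff_support_of_nonneg_ae (Eventually.of_forall hG0) hGint]
      exact ((isOpen_ne_fun hGc continuous_const).inter isOpen_Ioi).measure_pos volume
        ⟨s₀, hGs₀.ne', hs₀⟩
    exact hpos.ne' hGI
  -- Step E: conclusion, with `φ 0 = 0` by continuity from the right
  intro s hs
  rcases hs.lt_or_eq with hs' | hs'
  · exact hD s hs'
  · subst hs'
    have h1 : Tendsto φ (𝓝[Ioi (0 : ℝ)] 0) (𝓝 (φ 0)) :=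
      ((hφ 0 Set.self_mem_Ici).mono Ioi_subset_Ici_self).tendsto
    have h2 : Tendsto φ (𝓝[Ioi (0 : ℝ)] 0) (𝓝 0) :=
      tendsto_const_nhds.congr' <|
        eventually_nhdsWithin_of_forall fun s hs => (hD s hs).symm
    exact tendsto_nhds_unique h1 h2

end Summit.AtomisticToContinuum.FouriersLaw.Theorems.SubdiffusiveBondHeat

end
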